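import Literature.AlgebraicTopology.FundamentalGroup.DeformationRetractInclusion
import Literature.AlgebraicTopology.FundamentalGroup.VanKampenDeformation
import HarnessLib

/-!
# A retraction computes the inverse of the inclusion isomorphism on `π₁`

Topic `Literature/AlgebraicTopology/FundamentalGroup`; two small complements to Hatcher's
Prop. 1.17 (`DeformationRetractInclusion.lean`:
`bijective_inclHomOfSubset_of_isStrongDeformationRetractOf`), used by the fact seat
`provefact-Literature.Topology.FourManifolds.exists-cbed50d78a` to compute words in `π₁` of a
surface from an explicit retraction onto a spine.

* `inclHomOfSubset_fromPath_map_retraction` — if `π₁(A, x₀) → π₁(S, x₀)` (inclusion, `A ⊆ S`,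
  `x₀ ∈ A`) is bijective and `r : S → A` is *any* continuous retraction, then `i_*[r ∘ γ] = [γ]`
  for every loop `γ` of `S` at `x₀`: the inverse of the inclusion isomorphism is computed by any
  retraction, even when the deformation is only known to exist (`IsStrongDeformationRetractOf`
  is a proposition).
* `bijective_inclHomOfSubset_of_bijective_of_bijective` — two out of three: for `A ⊆ T ⊆ S`,
  if `π₁(A) → π₁(T)` and `π₁(A) → π₁(S)` are bijective then so is `π₁(T) → π₁(S)` (e.g. `T` and
  `S` both strong deformation retract onto `A`).

Everything is proved; no named facts.

## References

* A. Hatcher, *Algebraic Topology*, CUP (2002), Prop. 1.17. [HatcherAT2002]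
-/

noncomputable section

open scoped unitInterval Topology
open Set Function

namespace Literature.AlgebraicTopology.FundamentalGroup

namespace VanKampen

variable {Y : Type*} [TopologicalSpace Y] {A S : Set Y} {x₀ : Y}

/-- The inclusion-induced map on the class of a loop of `A` is the class of the same loop in `S`
(local copy of `CellAttachmentKernel.inclHomOfSubset_fromPath`, whose import closure is heavy).
[folklore] -/
private theorem inclHomOfSubset_fromPath' (hAS : A ⊆ S) (hxA : x₀ ∈ A)
    (γ : Path (⟨x₀, hxA⟩ : A) ⟨x₀, hxA⟩) :
    inclHomOfSubset hAS x₀ hxA (hAS hxA) (_root_.FundamentalGroup.fromPath (Path.Homotopic.Quotient.mk γ)) =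
      _root_.FundamentalGroup.fromPath (Path.Homotopic.Quotient.mk
        ((γ.map (ContinuousMap.inclusion hAS).continuous).cast rfl rfl)) := by
  rw [inclHomOfSubset, _root_.FundamentalGroup.mapOfEq_apply]
  rfl

/-- **A retraction computes the inverse of the inclusion isomorphism.**  Let `A ⊆ S`, `x₀ ∈ A`,
suppose the inclusion-induced `π₁(A, x₀) → π₁(S, x₀)` is bijective (e.g. `A` is a strong
deformation retract of `S`, `bijective_inclHomOfSubset_of_isStrongDeformationRetractOf`), and let
`r : S → A` be *any* continuous retraction (`r a = a` on `A`).  Then for every loop `γ` of `S` at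
`x₀` the class of `r ∘ γ` in `A` is the preimage of the class of `γ`: `i_*[r ∘ γ] = [γ]`.  (Write
`[γ] = i_*[β]`; then `r ∘ γ ≃ r ∘ i ∘ β = β`.)  This lets one compute in `π₁(S)` with an explicit
retraction even when the deformation is only known to exist. [cite: HatcherAT2002, Prop. 1.17] -/
theorem inclHomOfSubset_fromPath_map_retraction (hAS : A ⊆ S) (hxA : x₀ ∈ A)
    (hbij : Bijective (inclHomOfSubset hAS x₀ hxA (hAS hxA))) (r : C(S, A))
    (hr : ∀ a : A, r (ContinuousMap.inclusion hAS a) = a)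
    (γ : Path (⟨x₀, hAS hxA⟩ : S) ⟨x₀, hAS hxA⟩) :
    inclHomOfSubset hAS x₀ hxA (hAS hxA) (_root_.FundamentalGroup.fromPath (Path.Homotopic.Quotient.mk
      ((γ.map r.continuous).cast (hr ⟨x₀, hxA⟩).symm (hr ⟨x₀, hxA⟩).symm))) =
      _root_.FundamentalGroup.fromPath (Path.Homotopic.Quotient.mk γ) := by
  set ι : C(A, S) := ContinuousMap.inclusion hAS with hι
  have hr₀ : r ⟨x₀, hAS hxA⟩ = ⟨x₀, hxA⟩ := hr ⟨x₀, hxA⟩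
  -- `[γ] = i_*[β]`
  obtain ⟨c, hc⟩ := hbij.2 (_root_.FundamentalGroup.fromPath (Path.Homotopic.Quotient.mk γ))
  induction c using PushoutData.ind_fromPath with
  | h β =>
    have key := inclHomOfSubset_fromPath' hAS hxA β
    rw [key] at hc
    -- `i ∘ β ≃ γ`, hence `β = r ∘ i ∘ β ≃ r ∘ γ`
    have h1 : ((β.map ι.continuous).cast rfl rfl).Homotopic γ := Path.Homotopic.Quotient.exact hc
    have h2 := h1.map r
    have e : ((β.map ι.continuous).cast rfl rfl).map r.continuous = β.cast hr₀ hr₀ :=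
      Path.ext (funext fun t => hr (β t))
    rw [e] at h2
    have h3 : β.Homotopic ((γ.map r.continuous).cast hr₀.symm hr₀.symm) := h2
    have h4 : Path.Homotopic.Quotient.mk ((γ.map r.continuous).cast hr₀.symm hr₀.symm) =
        Path.Homotopic.Quotient.mk β := (Path.Homotopic.Quotient.eq.2 h3).symm
    rw [h4, key, hc]

/-- **Two out of three for inclusions.**  For `A ⊆ T ⊆ S` and `x₀ ∈ A`: if the inclusion-induced
maps `π₁(A, x₀) → π₁(T, x₀)` and `π₁(A, x₀) → π₁(S, x₀)` are bijective, then so is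
`π₁(T, x₀) → π₁(S, x₀)` (functoriality `i^{TS} ∘ i^{AT} = i^{AS}`). [folklore] -/
theorem bijective_inclHomOfSubset_of_bijective_of_bijective {T : Set Y} (hAT : A ⊆ T) (hTS : T ⊆ S)
    (hxA : x₀ ∈ A) (hT : Bijective (inclHomOfSubset hAT x₀ hxA (hAT hxA)))
    (hS : Bijective (inclHomOfSubset (hAT.trans hTS) x₀ hxA (hTS (hAT hxA)))) :
    Bijective (inclHomOfSubset hTS x₀ (hAT hxA) (hTS (hAT hxA))) := by
  have hcomp := inclHomOfSubset_comp hAT hTS hxA (hAT hxA) (hTS (hAT hxA)) (x₀ := x₀)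
  have hfun : ⇑(inclHomOfSubset hTS x₀ (hAT hxA) (hTS (hAT hxA))) ∘
      ⇑(inclHomOfSubset hAT x₀ hxA (hAT hxA)) = ⇑(inclHomOfSubset (hAT.trans hTS) x₀ hxA (hTS (hAT hxA))) := by
    have := congrArg (fun f : _ →* _ => ⇑f) hcomp
    simpa using this
  constructor
  · intro a b hab
    obtain ⟨a', rfl⟩ := hT.2 a
    obtain ⟨b', rfl⟩ := hT.2 b
    have h1 : inclHomOfSubset (hAT.trans hTS) x₀ hxA (hTS (hAT hxA)) a' =
        inclHomOfSubset (hAT.trans hTS) x₀ hxA (hTS (hAT hxA)) b' := by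
      rw [← hfun]; exact hab
    rw [hS.1 h1]
  · intro c
    obtain ⟨a, rfl⟩ := hS.2 c
    exact ⟨inclHomOfSubset hAT x₀ hxA (hAT hxA) a, by rw [← hfun]; rfl⟩

end VanKampen

end Literature.AlgebraicTopology.FundamentalGroup
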